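import Mathlib
import Summits.Ventures.HodgeRepro2.Tier7.Line3.KappaDataFinLocal
import Summits.Ventures.HodgeRepro2.Tier7.Line3.AdicCompletionInvolution

/-!
# Tier7/Line3/AdicCompletionRestriction — the κ-side local-field data at the real completion
(seat t7-x1, gen 4; KappaDataFinLocal's four local-field hypotheses discharged on Mathlib's completion)

LINE 3 (t7-plan-3), version (ii). L1-p5's KappaDataFinLocal (p685687) derives `KappaData`'s finite fields at a non-split
place `w` of the base field `K` from the local torus-translate condition over an abstract field `Ew` with involution `σw`,
an embedding `ψ : E →+* Ew`, an absolute value `abv` and the four LOCAL-FIELD hypotheses `hψ : ψ ∘ σ = σw ∘ ψ`,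
`hw : w x = abv (ψ (algebraMap K E x))` (restriction), `hna : IsNonarchimedean abv`, `hσ : abv ∘ σw = abv`. This module
discharges all four on Mathlib's completion `wE.adicCompletion E` of the CM field `E` at the place `wE` above `v`:

* `adicAbv_algebraMap : adicAbv E wE (algebraMap K E x) = adicAbv K v x ^ localDeg v wE` with
  `localDeg v wE := e · f` (`ramificationIdx'`, `inertiaDeg`) — `valuation_liesOver` for the valuation,
  `Ideal.absNorm_pow_inertiaDeg` for the base of `toNNReal` (`toNNReal_pow_base`);
* `rootAbv abv hna hr := abv ^ r` (`r > 0`), an absolute value again for a NONARCHIMEDEAN `abv` (`rootAbv_apply`,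
  `isNonarchimedean_rootAbv`); on `F := wE.adicCompletion E` the absolute value `abvRoot v wE := rootAbv normAbv _ (1/(e f))`
  RESTRICTS to the place `FinitePlace.mk v` of `K` (`finitePlace_eq_abvRoot`) and is invariant under the extended
  involution `completionMap wE σ hσ` (`abvRoot_completionMap`, from `norm_completionMap`);
* `embedding_apply_eq_completionMap`: `ψ := FinitePlace.embedding wE` intertwines `σ` and `completionMap wE σ hσ`;
* the consumers `hcong_field_local_adic` / `hout_field_local_adic` / `hS_field_local_adic` = KappaDataFinLocal's three
  theorems at `(Ew, σw, ψ, abv, w) := (wE.adicCompletion E, completionMap wE σ hσ, FinitePlace.embedding wE, abvRoot v wE,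
  FinitePlace.mk v)` with `hψ / hw / hna / hσ` GONE — only the adapted-coordinate data (`hκ`, `hf`, `hd`, `hdisc`, `hγ₀`,
  `hsupp`) remain displayed.

TWO ABSOLUTE VALUES ON ONE FIELD (crit-2 STATUS l. 15903 (3)(b)): `abvRoot v wE = ‖·‖ ^ (1/(e f))` is NOT the normalised
absolute value of `wE.adicCompletion E` (a uniformiser of `E` at `wE` has `abvRoot = N(wE)^(−1/(e f))`, not `N(wE)⁻¹`); the
level reading of AdicCompletionLevel (`q := q wE`, `levelTower` against `‖·‖`, `norm_le_pow_iff`) and the κ-side `abvRoot`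
coexist on the same completion, each consumed BY NAME on its own side — no level clause reads `abvRoot` for `‖·‖`. The `hψ`
clause `embedding_apply_eq_completionMap` is p703979's `completionMap_embedding` (the extension property of `completionMap`
on the image of `E`), read backwards (l. 15903 (3)(a)); `e`, `f` are Mathlib's `ramificationIdx'` / `inertiaDeg` under
`[wE.asIdeal.LiesOver v.asIdeal]`, both positive (`localDeg_pos`), so `1/(e f) > 0` feeds `rootAbv` (l. 15903 (3)(c)).
This is the κ-side twin of the `b`-side rows (ConcreteLevelFactor p698828 → AdicCompletionLocalField p703140 →
AdicCompletionInvolution p703979): KappaDataFinLocal's in-words «choice of `E_w`, `ψ_w`, `abv_w` above `w` (restriction =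
`hw`)» becomes Mathlib's completion with the ROOT of the normalised absolute value — the (E)-discharge's
«`abv = |·|_{w̃}^{1/2}`» (proofs/t7/L3/X1-RESIDUAL-TYPED.md) with `1/2 = 1/(e f)` at a non-split place of the quadratic
`E/K`. DICTIONARY (in words): `K = E⁺`, `E` the CM field, `σ` its involution (`hσ` from AdicValuationInvariant), `v = v₁`
inert, `wE` the place above it. Nothing here is about (N), (P), the real `X`, or HC_CM; §8(d): NO. Blind lane: Mathlib +
the HodgeRepro2 prefix; no sorry; axioms ⊆ {propext, Classical.choice, Quot.sound}.
-/

namespace Summit.Ventures.HodgeRepro2.Tier7.Line3.AdicCompletionRestriction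

open IsDedekindDomain IsDedekindDomain.HeightOneSpectrum NumberField WithZeroMulInt WithZero Matrix
  Summit.Ventures.HodgeRepro2.Tier7.Line3.LevelTowerTopology
  Summit.Ventures.HodgeRepro2.Tier7.Line3.AdicCompletionInvolution
  Summit.Ventures.HodgeRepro2.Tier7.Line3.KappaDataFinLocal
  Summit.Ventures.HodgeRepro2.T7SupportTwoTorusInvariant
open scoped NumberField WithZero NNReal

/-! ## Roots of a nonarchimedean absolute value -/

section rootAbv

variable {F : Type*} [Field F] (abv : AbsoluteValue F ℝ) (hna : IsNonarchimedean abv) {r : ℝ} (hr : 0 < r)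

/-- the `r`-th power (`r > 0`) of a nonarchimedean absolute value is an absolute value. -/
noncomputable def rootAbv : AbsoluteValue F ℝ where
  toFun x := abv x ^ r
  map_mul' x y := by rw [map_mul, Real.mul_rpow (abv.nonneg x) (abv.nonneg y)]
  nonneg' x := Real.rpow_nonneg (abv.nonneg x) r
  eq_zero' x := by
    rw [Real.rpow_eq_zero_iff_of_nonneg (abv.nonneg x)]
    constructor
    · rintro ⟨h, _⟩
      exact abv.eq_zero.1 h
    · intro h
      exact ⟨abv.eq_zero.2 h, hr.ne'⟩
  add_le' x y := by
    calc abv (x + y) ^ r ≤ max (abv x) (abv y) ^ r := Real.rpow_le_rpow (abv.nonneg _) (hna x y) hr.le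
      _ ≤ abv x ^ r + abv y ^ r := by
        rcases le_total (abv x) (abv y) with hxy | hxy
        · rw [max_eq_right hxy]
          exact le_add_of_nonneg_left (Real.rpow_nonneg (abv.nonneg x) r)
        · rw [max_eq_left hxy]
          exact le_add_of_nonneg_right (Real.rpow_nonneg (abv.nonneg y) r)

/-- `rootAbv` on elements. -/
theorem rootAbv_apply (x : F) : rootAbv abv hna hr x = abv x ^ r := rfl

/-- the root of a nonarchimedean absolute value is nonarchimedean. -/
theorem isNonarchimedean_rootAbv : IsNonarchimedean (rootAbv abv hna hr) := fun x y => by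
  simp only [rootAbv_apply]
  calc abv (x + y) ^ r ≤ max (abv x) (abv y) ^ r := Real.rpow_le_rpow (abv.nonneg _) (hna x y) hr.le
    _ = max (abv x ^ r) (abv y ^ r) := by
      rcases le_total (abv x) (abv y) with hxy | hxy
      · rw [max_eq_right hxy, max_eq_right (Real.rpow_le_rpow (abv.nonneg x) hxy hr.le)]
      · rw [max_eq_left hxy, max_eq_left (Real.rpow_le_rpow (abv.nonneg y) hxy hr.le)]

end rootAbv

/-! ## The restriction of the absolute value of `E` at `wE` to `K` -/

section restriction

variable {K E : Type*} [Field K] [NumberField K] [Field E] [NumberField E] [Algebra K E]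
  (v : HeightOneSpectrum (𝓞 K)) (wE : HeightOneSpectrum (𝓞 E)) [wE.asIdeal.LiesOver v.asIdeal]

/-- the local degree `e · f` of `wE` over `v`. -/
noncomputable def localDeg : ℕ := v.asIdeal.ramificationIdx' wE.asIdeal * wE.asIdeal.inertiaDeg (𝓞 K)

/-- the local degree is positive. -/
theorem localDeg_pos : 0 < localDeg v wE := by
  unfold localDeg
  exact Nat.pos_of_ne_zero (mul_ne_zero (Ideal.IsDedekindDomain.ramificationIdx'_ne_zero_of_liesOver wE.asIdeal v.ne_bot)
    (Ideal.inertiaDeg_pos wE.asIdeal (𝓞 K)).ne')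

/-- `toNNReal` only depends on the base through its value. -/
theorem toNNReal_congr_base {e₁ e₂ : ℝ≥0} (h₁ : e₁ ≠ 0) (h₂ : e₂ ≠ 0) (h : e₁ = e₂) (y : ℤᵐ⁰) :
    toNNReal h₁ y = toNNReal h₂ y := by
  subst h
  rfl

/-- `toNNReal` at the base `N ^ f` is the `f`-th power of `toNNReal` at the base `N` (`f ≠ 0`). -/
theorem toNNReal_pow_base {N : ℝ≥0} (hN : N ≠ 0) {f : ℕ} (hf : f ≠ 0) (hNf : N ^ f ≠ 0) (y : ℤᵐ⁰) :
    toNNReal hNf y = toNNReal hN y ^ f := by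
  rcases eq_or_ne y 0 with rfl | hy
  · rw [map_zero, map_zero, zero_pow hf]
  · rw [toNNReal_neg_apply _ hy, toNNReal_neg_apply _ hy, ← zpow_natCast N f, ← _root_.zpow_mul,
      ← zpow_natCast (N ^ (WithZero.unzero hy).toAdd) f, ← _root_.zpow_mul, mul_comm]

/-- the base of the absolute value at `wE` is the `f`-th power of the base at `v`. -/
theorem absNorm_eq_pow :
    (Ideal.absNorm wE.asIdeal : ℝ≥0) = (Ideal.absNorm v.asIdeal : ℝ≥0) ^ wE.asIdeal.inertiaDeg (𝓞 K) := by
  rw [← Ideal.absNorm_pow_inertiaDeg v.asIdeal wE.asIdeal]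
  push_cast
  rfl

/-- **the absolute value of `E` at `wE`, restricted to `K`, is the `e · f`-th power of the absolute value at `v`.** -/
theorem adicAbv_algebraMap (x : K) :
    NumberField.HeightOneSpectrum.adicAbv E wE (algebraMap K E x) =
      NumberField.HeightOneSpectrum.adicAbv K v x ^ localDeg v wE := by
  rw [NumberField.HeightOneSpectrum.adicAbv_def, NumberField.HeightOneSpectrum.adicAbv_def,
    ← valuation_liesOver E v wE x, map_pow, localDeg, mul_comm, pow_mul,
    toNNReal_congr_base (NumberField.HeightOneSpectrum.absNorm_ne_zero wE)
      (pow_ne_zero _ (NumberField.HeightOneSpectrum.absNorm_ne_zero v)) (absNorm_eq_pow v wE),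
    toNNReal_pow_base (NumberField.HeightOneSpectrum.absNorm_ne_zero v) (Ideal.inertiaDeg_pos wE.asIdeal (𝓞 K)).ne']
  push_cast
  rfl

end restriction

/-! ## The root absolute value on the completion and the place of `K` -/

section completion

variable {K E : Type*} [Field K] [NumberField K] [Field E] [NumberField E] [Algebra K E]
  (v : HeightOneSpectrum (𝓞 K)) (wE : HeightOneSpectrum (𝓞 E)) [wE.asIdeal.LiesOver v.asIdeal]

/-- the exponent `1 / (e f)`. -/
noncomputable def rootExp : ℝ := ((localDeg v wE : ℕ) : ℝ)⁻¹

/-- the exponent is positive. -/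
theorem rootExp_pos : 0 < rootExp v wE := by
  unfold rootExp
  exact inv_pos.2 (Nat.cast_pos.2 (localDeg_pos v wE))

/-- **the root absolute value** `‖·‖ ^ (1/(e f))` on `wE.adicCompletion E`. -/
noncomputable def abvRoot : AbsoluteValue (wE.adicCompletion E) ℝ :=
  rootAbv normAbv isNonarchimedean_normAbv (rootExp_pos v wE)

/-- `abvRoot` on elements. -/
theorem abvRoot_apply (y : wE.adicCompletion E) : abvRoot v wE y = ‖y‖ ^ rootExp v wE := rfl

/-- `abvRoot` is nonarchimedean. -/
theorem isNonarchimedean_abvRoot : IsNonarchimedean (abvRoot v wE) :=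
  isNonarchimedean_rootAbv normAbv isNonarchimedean_normAbv (rootExp_pos v wE)

/-- **`abvRoot` restricts to the place `v` of `K`** through `K → E → wE.adicCompletion E`. -/
theorem finitePlace_eq_abvRoot (x : K) :
    FinitePlace.mk v x = abvRoot v wE (FinitePlace.embedding wE (algebraMap K E x)) := by
  rw [abvRoot_apply, FinitePlace.mk_apply, FinitePlace.norm_embedding, FinitePlace.norm_embedding,
    adicAbv_algebraMap v wE x, rootExp,
    Real.pow_rpow_inv_natCast (AbsoluteValue.nonneg _ _) (localDeg_pos v wE).ne']

variable (σ : E →+* E) (hσ : ∀ x, wE.valuation E (σ x) = wE.valuation E x)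

/-- `abvRoot` is invariant under the extended involution. -/
theorem abvRoot_completionMap (y : wE.adicCompletion E) :
    abvRoot v wE (completionMap wE σ hσ y) = abvRoot v wE y := by
  rw [abvRoot_apply, abvRoot_apply, norm_completionMap]

/-- the embedding intertwines `σ` and the extended involution. -/
theorem embedding_apply_eq_completionMap (x : E) :
    FinitePlace.embedding wE (σ x) = completionMap wE σ hσ (FinitePlace.embedding wE x) :=
  (completionMap_embedding wE σ hσ x).symm

/-! ## The κ-side fields at the real completion (KappaDataFinLocal with the local-field hypotheses discharged) -/

variable (d : Fin 2 → E) (f : Fin 2 → Fin 2 → E) {Orb : Type*} (matO : Orb → Matrix (Fin 2) (Fin 2) E)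
  (κF : Orb → K) (arith : ℕ → Orb → Prop) (γ₀ : Orb)

/-- **`hcong` at the real completion** (KappaDataFinLocal.hcong_field_local at `wE.adicCompletion E`, `hψ / hw / hna / hσ`
discharged). -/
theorem hcong_field_local_adic
    (hκ : ∀ γ, algebraMap K E (κF γ) = kappa σ d f (matO γ))
    (hf : ∀ i, abvRoot v wE (FinitePlace.embedding wE (f 0 i)) ≤ 1)
    (hd : abvRoot v wE (FinitePlace.embedding wE (d 0)) ≤ 1)
    (hdisc : abvRoot v wE (FinitePlace.embedding wE (d 0) *
      disc' (completionMap wE σ hσ) (fun i => FinitePlace.embedding wE (d i))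
        (fun j i => FinitePlace.embedding wE (f j i)) 0) = 1)
    {q : ℝ} (hq : 1 < q) (γ₀w : Matrix (Fin 2) (Fin 2) (wE.adicCompletion E))
    (hγ₀ : IsTranslate (completionMap wE σ hσ) (fun j i => FinitePlace.embedding wE (f j i))
      ((matO γ₀).map (FinitePlace.embedding wE)) γ₀w)
    (hγ₀int : ∀ i j, abvRoot v wE (γ₀w i j) ≤ 1)
    (hsupp : ∀ N γ, arith N γ → ∃ k : Matrix (Fin 2) (Fin 2) (wE.adicCompletion E),
      IsTranslate (completionMap wE σ hσ) (fun j i => FinitePlace.embedding wE (f j i))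
        ((matO γ).map (FinitePlace.embedding wE)) (γ₀w * k) ∧ ∀ i j, abvRoot v wE ((k - 1) i j) ≤ q⁻¹ ^ N) :
    ∀ N γ, arith N γ → FinitePlace.mk v (κF γ - κF γ₀) ≤ q⁻¹ ^ N :=
  hcong_field_local σ (completionMap wE σ hσ) (FinitePlace.embedding wE) (abvRoot v wE) d f matO κF
    (FinitePlace.mk v) arith γ₀ (embedding_apply_eq_completionMap wE σ hσ) (finitePlace_eq_abvRoot v wE) hκ
    (isNonarchimedean_abvRoot v wE) (abvRoot_completionMap v wE σ hσ) hf hd hdisc hq γ₀w hγ₀ hγ₀int hsupp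

/-- **`hout` at the real completion** (KappaDataFinLocal.hout_field_local, `hψ / hw / hna / hσ` discharged). -/
theorem hout_field_local_adic
    (hκ : ∀ γ, algebraMap K E (κF γ) = kappa σ d f (matO γ))
    (hf : ∀ i, abvRoot v wE (FinitePlace.embedding wE (f 0 i)) ≤ 1)
    (hd : abvRoot v wE (FinitePlace.embedding wE (d 0)) ≤ 1)
    (hdisc : abvRoot v wE (FinitePlace.embedding wE (d 0) *
      disc' (completionMap wE σ hσ) (fun i => FinitePlace.embedding wE (d i))
        (fun j i => FinitePlace.embedding wE (f j i)) 0) = 1)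
    (hγ₀ : ∃ m₀, IsTranslate (completionMap wE σ hσ) (fun j i => FinitePlace.embedding wE (f j i))
      ((matO γ₀).map (FinitePlace.embedding wE)) m₀ ∧ ∀ i j, abvRoot v wE (m₀ i j) ≤ 1)
    (hsupp : ∀ N γ, arith N γ → ∃ m, IsTranslate (completionMap wE σ hσ)
      (fun j i => FinitePlace.embedding wE (f j i)) ((matO γ).map (FinitePlace.embedding wE)) m ∧
      ∀ i j, abvRoot v wE (m i j) ≤ 1) :
    ∀ N γ, arith N γ → FinitePlace.mk v (κF γ - κF γ₀) ≤ 1 :=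
  hout_field_local σ (completionMap wE σ hσ) (FinitePlace.embedding wE) (abvRoot v wE) d f matO κF
    (FinitePlace.mk v) arith γ₀ (embedding_apply_eq_completionMap wE σ hσ) (finitePlace_eq_abvRoot v wE) hκ
    (isNonarchimedean_abvRoot v wE) (abvRoot_completionMap v wE σ hσ) hf hd hdisc hγ₀ hsupp

/-- **`hS` at the real completion** (KappaDataFinLocal.hS_field_local, `hψ / hw / hna / hσ` discharged). -/
theorem hS_field_local_adic
    (hκ : ∀ γ, algebraMap K E (κF γ) = kappa σ d f (matO γ))
    {M : ℝ} (hM : 0 ≤ M) (hf : ∀ i, abvRoot v wE (FinitePlace.embedding wE (f 0 i)) ≤ M)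
    (hd : abvRoot v wE (FinitePlace.embedding wE (d 0)) ≤ M)
    (hγ₀ : ∃ m₀, IsTranslate (completionMap wE σ hσ) (fun j i => FinitePlace.embedding wE (f j i))
      ((matO γ₀).map (FinitePlace.embedding wE)) m₀ ∧ ∀ i j, abvRoot v wE (m₀ i j) ≤ M)
    (hsupp : ∀ N γ, arith N γ → ∃ m, IsTranslate (completionMap wE σ hσ)
      (fun j i => FinitePlace.embedding wE (f j i)) ((matO γ).map (FinitePlace.embedding wE)) m ∧
      ∀ i j, abvRoot v wE (m i j) ≤ M) :
    ∀ N γ, arith N γ → FinitePlace.mk v (κF γ - κF γ₀) ≤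
      M ^ 6 / abvRoot v wE (FinitePlace.embedding wE (d 0) *
        disc' (completionMap wE σ hσ) (fun i => FinitePlace.embedding wE (d i))
          (fun j i => FinitePlace.embedding wE (f j i)) 0) :=
  hS_field_local σ (completionMap wE σ hσ) (FinitePlace.embedding wE) (abvRoot v wE) d f matO κF
    (FinitePlace.mk v) arith γ₀ (embedding_apply_eq_completionMap wE σ hσ) (finitePlace_eq_abvRoot v wE) hκ
    (isNonarchimedean_abvRoot v wE) (abvRoot_completionMap v wE σ hσ) hM hf hd hγ₀ hsupp

end completion

end Summit.Ventures.HodgeRepro2.Tier7.Line3.AdicCompletionRestriction
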